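import Literature.NumberTheory.LFunctions.ZetaDerivativeZerosSmallGaps
import HarnessLib

/-!
# Small gaps between zeros of `ζ` ⇔ zeros of `ζ′` near the half-line, quantitatively
# (Radziwiłł 2014, Main Theorem, Theorem 1, Corollary 2) — the power-law form of the `ζ′`-route to
# «no Landau–Siegel zero» via Conrey–Iwaniec

Topic `Literature/NumberTheory/LFunctions` (namespace `Literature.NumberTheory.LFunctions`; the
paper's dyadic, `log T`-normalised counting functions live in the sub-namespace `Radziwill2014`).
STATEMENT LAYER for the LANDAU–SIEGEL programme, sub-cell §C (harvest row r2-T12; lens oqh +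
nearmiss, tag E*-ℓ): the quantitative form of the line Farmer–Ki 2012 (tree:
`farmerKi2012_theorem13`, `ZetaDerivativeZerosSmallGaps.lean`, IMPORTED — nothing there is retyped)
→ Radziwiłł 2014 → Ge 2017, in which Conrey–Iwaniec's spacing hypothesis (tree:
`conreyIwaniec2002_theorem11/12`) is traded for a hypothesis on the HORIZONTAL distribution of the
zeros of `ζ′`. Three NAMED FACTS (D-0014, `def … : Prop`, nothing asserted): the two halves of the
Main Theorem and Corollary 2; PROVED bookkeeping: monotonicity of the two counts in the threshold,
and Theorem 1's shape ⇒ the first half of the Main Theorem is the special case recorded in print.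

## What the source prints (held text `paper:arxiv-1301.3232` = Adv. Math. 257 (2014) 6–24, read
2026-08-26; "Note: Throughout we assume the Riemann Hypothesis" p0001:L21)

p0002:L1–23: "Following Farmer and Ki we introduce two distribution functions,
`m′(ε) := liminf_{T→∞} (2π/(T log T)) Σ_{T ≤ γ′ ≤ 2T} w((β′ − ½) log T/ε)`,
`m(ε) := liminf_{T→∞} (2π/(T log T)) Σ_{T ≤ γ ≤ 2T} w((γ⁺ − γ) log T/ε)`" (`w` = indicator of
`[0,1]`; `ρ′ = β′ + iγ′` zeros of `ζ′`, `γ⁺` "the ordinate succeeding `γ`").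
p0002:L43–45: "**Main Theorem.** Let `A, δ > 0` be given.
• If `m′(ε) ≫ ε^A` as `ε → 0` then `m(ε^{1/2}) ≫ ε^{A+δ}` for all `ε ≤ 1`.
• If `m(ε^{1/2}) ≫ ε^A` as `ε → 0` then `m′(ε) ≫ ε^{A+δ}` for all `ε ≤ 1`."
p0003:L7–11: "**Corollary 2.** Let `A > 0`. If `m′(ε) ≫ ε^A`, for all `ε > 0`, then for primitive
characters `χ` modulo `q`, `L(1; χ) > (log q)^{−18}` for all `q` sufficiently large. *Proof.* If
`m′(ε) ≫ ε^A` for every `ε > 0` then `m(1/4) > 0` by our Main Theorem, hence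
`L(1; χ) > (log q)^{−18}` for all `q` sufficiently large by Theorem 1.1 of Conrey–Iwaniec."
p0003:L28–30: "**Theorem 1.** Let `A, δ > 0`. There is a constant `C = C(δ, A)` such that if
`0 < ε < C` and `m′(ε) ≥ cε^A` then `m(ε^{1/2−δ}) ≥ (c/8)ε^A`. The approximate value of `C(δ, A)`
is `(Bδ/A)^{32A/δ}` with `B` an absolute constant."
p0003:L19–25 (the author's open question, kept in the harvest row r2-OQ09, not typed).

## Lean rendering / design choices

* COUNTS. `m` is rendered over the tree's non-decreasing enumeration `zetaOrdinate n` of ALL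
  ordinates (with multiplicity; `ZeroGaps.lean`): `Radziwill2014.smallGapCount ε T` = number of
  indices `n` with `T ≤ γ_n ≤ 2T` and `(γ_{n+1} − γ_n) log T ≤ ε`. Reading "`γ⁺` = the next term
  of the sequence with multiplicity" makes a multiple zero a gap `0`; this can only ENLARGE the
  count relative to a distinct-ordinate reading, so a LOWER bound concluded for it is at most
  WEAKER than print (safe direction for part (i) and Corollary 2), and a lower bound ASSUMED for it
  (part (ii)) is at most easier to satisfy — there the rendered fact could be stronger than print
  only if print meant distinct ordinates; on RH (the paper's standing assumption) Radziwiłł's own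
  proof of part (ii) (§8, "Suppose that there are at least `cε^A·T log T` zeros `T ≤ γ ≤ 2T` such
  that `γ⁺ − γ ≤ …`", built on Zhang's lemma which allows `γ⁺ = γ` for multiple zeros) uses the
  with-multiplicity reading; recorded here, and part (ii) is typed in that reading.
  `m′` counts DISTINCT zeros `ρ′` of `ζ′` with `T ≤ Im ρ′ ≤ 2T` and `(Re ρ′ − ½) log T ≤ ε`
  (`Set.ncard`, as in `FarmerKi2012.derivZerosNearLine`; distinct points make a lower-bound
  hypothesis harder to satisfy and a lower-bound conclusion weaker — safe in both parts).
* "`f(ε) ≫ ε^A` as `ε → 0`" for a `liminf` in `T` is rendered with explicit constants and an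
  eventual-in-`T` inequality: `∃ c > 0, ∃ ε₀ > 0, ∀ ε ∈ (0, ε₀], ∃ T₀, ∀ T ≥ T₀,
  (2π/(T log T))·count ≥ c ε^A`. At the level of an existential constant this is EQUIVALENT to the
  `liminf` form (`liminf ≥ cε^A ⇒` eventually `≥ (c/2)ε^A`, and conversely eventually `≥ cε^A ⇒
  liminf ≥ cε^A`), so no strength is gained or lost. "for all `ε ≤ 1`" in the conclusions is
  `∀ ε ∈ (0, 1]`.
* Corollary 2 is typed for the case its printed proof covers: `χ` REAL primitive of conductor
  `q` with `χ(−1) = −1` (Conrey–Iwaniec's Theorem 1.1 concerns `K = ℚ(√−q)`); print says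
  "primitive characters `χ` modulo `q`" (for complex `χ` the bound is classical, for even real `χ`
  the cited theorem does not apply) — the typed statement is therefore at most WEAKER than print.
  DERIVATION GAP RECORDED, NOT REPAIRED: the one-line printed deduction via CI02 Theorem 1.1 yields
  `(log q)^{−18−4A′}` for any `A′ > 0` rather than exactly `−18` (the hypothesis (1.20) needs
  `A′ > 0`); the exponent is vendored AS PRINTED, as in the tree's treatment of CI02 Corollary 1.3.
* RH is Mathlib's `RiemannHypothesis`, a HYPOTHESIS of every fact here (standing assumption of the
  paper). Nothing is RH-bearing.

## Second section: Ge 2017 (the successor in range 2015–26; harvest row r2-T13)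

Held text `paper:arxiv-1510.04359` = Adv. Math. 320 (2017) 574–594 (F. Ge), read 2026-08-26.
p0001:L11–12: "If `ζ(1/2 + iγ) = 0`, let `γ⁺` denote the smallest `t > γ` with `ζ(1/2 + it) = 0`."
p0002:L2–21: `m′(v)`, `m(v)` as in Farmer–Ki/Radziwiłł, dyadic and `log T`-normalised, with
`w((γ_{n+1} − γ_n) log T/(2πv))` in `m` (so Ge's `m(v/2π)` is Radziwiłł's `m(v)`).
p0002:L43–50: "**Theorem 1.** Assume RH. There exists an absolute constant `c > 0`, such that
`m(v/2π) ≤ m′(v²)` for all `v < c`. … **Theorem 2.** Assume RH. There exists an absolute constant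
`c > 0` such that for any `v < c` the following holds: For all large `γ` with `γ⁺ − γ < v/log γ`,
the box `{s = σ + it : ½ < σ < ½ + v²/(4 log γ), γ ≤ t ≤ γ⁺}` contains exactly one zero of
`ζ′(s)`. Moreover, the zero is not on the boundary of the box."
p0003:L13–18: "**Theorem 3.** Assume RH. … In particular, we have
`liminf_{γ′→∞, β′>1/2} (β′ − 1/2)(log γ′)³ = 0 ⟹ liminf_{γ→∞} (γ⁺ − γ) log γ = 0` (3)."
Rendering: Theorem 1 as an inequality of `Filter.liminf`s of the two ratios (both are `≥ 0` and
`O(1)`, so Mathlib's real `liminf` is the classical one); Theorem 2 with the next-critical-ordinate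
predicate `Ge2017.IsNextCriticalOrdinate` and "exactly one zero" as `∃!` over points (implied by
either multiplicity reading); of Theorem 3 only the displayed implication (3) is typed (the
preceding `≪`-inequality is garbled in the held extraction and is left out deliberately).

WHAT THIS IS NOT: no claim about zeros of `ζ′`, about gaps, or about Siegel zeros; Radziwiłł's
Corollary 1 (PCC ⇒ `ε^{3/2±δ}` bounds for `m′`) and §2 Propositions, Ge's Theorems 4–5 and the
first display of his Theorem 3 are index-only.

## References

* [Radziwill2014ZetaPrimeGaps] M. Radziwiłł, *Gaps between zeros of ζ(s) and the distribution of
  zeros of ζ′(s)*, Adv. Math. 257 (2014) 6–24 = arXiv:1301.3232: p.2 (definitions, Main Theorem),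
  p.3 (Theorem 1, Corollary 2).
* [Ge2017ZetaPrimeGaps] F. Ge, *The distribution of zeros of ζ′(s) and gaps between zeros of ζ(s)*,
  Adv. Math. 320 (2017) 574–594 = arXiv:1510.04359: pp. 1–3 (Theorems 1–3).
* [FarmerKi2012] (tree file `ZetaDerivativeZerosSmallGaps.lean`), [ConreyIwaniec2002] Theorem 1.1
  (tree `conreyIwaniec2002_theorem11`).
-/

noncomputable section

open Real

namespace Literature.NumberTheory.LFunctions

namespace Radziwill2014

/-- **`#{T ≤ γ_n ≤ 2T : (γ_{n+1} − γ_n) log T ≤ ε}`** — indices of `ε`-small `log T`-normalised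
gaps between consecutive ordinates (the tree's `zetaOrdinate`, with multiplicity) in the dyadic
window `[T, 2T]`; the numerator of `m(ε)` before the factor `2π/(T log T)`.
[cite: Radziwill2014ZetaPrimeGaps, §1 p. 2 (definition of m(ε))] -/
def smallGapCount (ε T : ℝ) : ℕ :=
  {n : ℕ | T ≤ zetaOrdinate n ∧ zetaOrdinate n ≤ 2 * T ∧
    (zetaOrdinate (n + 1) - zetaOrdinate n) * Real.log T ≤ ε}.ncard

/-- **The zeros `ρ′ = β′ + iγ′` of `ζ′` with `T ≤ γ′ ≤ 2T` and `(β′ − ½) log T ≤ ε`** (distinct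
points); its cardinality is the numerator of `m′(ε)`.
[cite: Radziwill2014ZetaPrimeGaps, §1 p. 2 (definition of m′(ε))] -/
def derivZerosNearLine (ε T : ℝ) : Set ℂ :=
  {ρ : ℂ | deriv riemannZeta ρ = 0 ∧ T ≤ ρ.im ∧ ρ.im ≤ 2 * T ∧ (ρ.re - 1 / 2) * Real.log T ≤ ε}

/-- The normalised gap ratio `(2π/(T log T)) · #{T ≤ γ_n ≤ 2T : (γ_{n+1} − γ_n) log T ≤ ε}` whose
`liminf` in `T` is `m(ε)`. [cite: Radziwill2014ZetaPrimeGaps, §1 p. 2 (definition of m(ε))] -/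
def gapRatio (ε T : ℝ) : ℝ :=
  2 * π / (T * Real.log T) * (smallGapCount ε T : ℝ)

/-- The normalised ratio `(2π/(T log T)) · #{T ≤ γ′ ≤ 2T : (β′ − ½) log T ≤ ε}` whose `liminf` in
`T` is `m′(ε)`. [cite: Radziwill2014ZetaPrimeGaps, §1 p. 2 (definition of m′(ε))] -/
def derivRatio (ε T : ℝ) : ℝ :=
  2 * π / (T * Real.log T) * ((derivZerosNearLine ε T).ncard : ℝ)

/-- **"`m′(ε) ≫ ε^A` as `ε → 0`"** with explicit constants: for `0 < ε ≤ ε₀`, eventually in `T`,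
`(2π/(T log T))·#{T ≤ γ′ ≤ 2T : (β′ − ½) log T ≤ ε} ≥ c ε^A` (equivalent, at the level of `∃ c`,
to `liminf ≥ cε^A`). A PREDICATE, never asserted.
[cite: Radziwill2014ZetaPrimeGaps, Main Theorem p. 2 (hypothesis of part (i))] -/
def DerivLowerBound (A c ε₀ : ℝ) : Prop :=
  ∀ ε : ℝ, 0 < ε → ε ≤ ε₀ → ∃ T₀ : ℝ, ∀ T : ℝ, T₀ ≤ T → c * ε ^ A ≤ derivRatio ε T

/-- **"`m(ε^{1/2}) ≫ ε^A` as `ε → 0`"** with explicit constants: for `0 < ε ≤ ε₀`, eventually in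
`T`, `(2π/(T log T))·#{T ≤ γ_n ≤ 2T : (γ_{n+1} − γ_n) log T ≤ ε^{1/2}} ≥ c ε^A`. A PREDICATE.
[cite: Radziwill2014ZetaPrimeGaps, Main Theorem p. 2 (hypothesis of part (ii))] -/
def GapLowerBound (A c ε₀ : ℝ) : Prop :=
  ∀ ε : ℝ, 0 < ε → ε ≤ ε₀ → ∃ T₀ : ℝ, ∀ T : ℝ, T₀ ≤ T → c * ε ^ A ≤ gapRatio (Real.sqrt ε) T

end Radziwill2014

open Radziwill2014

/-! ### The named facts -/

/-- **Radziwiłł 2014, Main Theorem, part (i)** ("Throughout we assume the Riemann Hypothesis"):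
"Let `A, δ > 0` be given. If `m′(ε) ≫ ε^A` as `ε → 0` then `m(ε^{1/2}) ≫ ε^{A+δ}` for all
`ε ≤ 1`." Rendered: under RH, for `A, δ > 0`, if for some `c > 0`, `ε₀ > 0` the `ζ′`-count ratio
is eventually `≥ cε^A` for every `0 < ε ≤ ε₀`, then for some `c′ > 0` the gap-count ratio at
threshold `ε^{1/2}` is eventually `≥ c′ε^{A+δ}` for every `0 < ε ≤ 1`. NAMED FACT, not proved here
(§§2–6 of the source). [cite: Radziwill2014ZetaPrimeGaps, Main Theorem part (i) (p. 2)] -/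
def radziwill2014_mainTheorem_i : Prop :=
  RiemannHypothesis → ∀ (A δ : ℝ), 0 < A → 0 < δ →
    (∃ c : ℝ, 0 < c ∧ ∃ ε₀ : ℝ, 0 < ε₀ ∧ DerivLowerBound A c ε₀) →
      ∃ c' : ℝ, 0 < c' ∧ GapLowerBound (A + δ) c' 1

/-- **Radziwiłł 2014, Main Theorem, part (ii)** (RH standing): "If `m(ε^{1/2}) ≫ ε^A` as `ε → 0`
then `m′(ε) ≫ ε^{A+δ}` for all `ε ≤ 1`." Rendered as for part (i) with the roles exchanged (gap
count with multiplicity in the hypothesis — the reading used by the printed proof, §8). NAMED FACT,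
not proved here (§§7–8 of the source, building on Zhang 2001).
[cite: Radziwill2014ZetaPrimeGaps, Main Theorem part (ii) (p. 2)] -/
def radziwill2014_mainTheorem_ii : Prop :=
  RiemannHypothesis → ∀ (A δ : ℝ), 0 < A → 0 < δ →
    (∃ c : ℝ, 0 < c ∧ ∃ ε₀ : ℝ, 0 < ε₀ ∧ GapLowerBound A c ε₀) →
      ∃ c' : ℝ, 0 < c' ∧ DerivLowerBound (A + δ) c' 1

/-- **Radziwiłł 2014, Corollary 2** (RH standing): "Let `A > 0`. If `m′(ε) ≫ ε^A`, for all `ε > 0`,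
then for primitive characters `χ` modulo `q`, `L(1; χ) > (log q)^{−18}` for all `q` sufficiently
large" (proof: `m(1/4) > 0` by the Main Theorem, then Conrey–Iwaniec's Theorem 1.1). Rendered for
the case the printed proof covers — `χ` REAL (quadratic) primitive and ODD, conductor `q` — with
"`≫` as `ε → 0`" as in part (i) and "`q` sufficiently large" as `∃ q₀, ∀ q ≥ q₀`; exponent `−18`
AS PRINTED (derivation gap recorded in the module docstring). NAMED FACT, not proved here.
[cite: Radziwill2014ZetaPrimeGaps, Corollary 2 (p. 3)] -/
def radziwill2014_corollary2 : Prop :=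
  RiemannHypothesis → ∀ A : ℝ, 0 < A →
    (∃ c : ℝ, 0 < c ∧ ∃ ε₀ : ℝ, 0 < ε₀ ∧ DerivLowerBound A c ε₀) →
      ∃ q₀ : ℕ, ∀ (q : ℕ) [NeZero q], q₀ ≤ q → ∀ χ : DirichletCharacter ℂ q,
        χ.IsPrimitive → χ.IsQuadratic → χ.Odd →
          Real.log q ^ (-(18 : ℝ)) < ‖χ.LFunction 1‖

/-! ### Bookkeeping (proved) -/

namespace Radziwill2014

/-- The set of `ε`-close zeros of `ζ′` grows with `ε`. [cite: Radziwill2014ZetaPrimeGaps, §1 p. 2 (definition of m′(ε))] -/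
theorem derivZerosNearLine_mono {ε ε' : ℝ} (h : ε ≤ ε') (T : ℝ) :
    derivZerosNearLine ε T ⊆ derivZerosNearLine ε' T :=
  fun _ hρ => ⟨hρ.1, hρ.2.1, hρ.2.2.1, hρ.2.2.2.trans h⟩

/-- The gap count is monotone in the threshold (on index sets known to be finite).
[cite: Radziwill2014ZetaPrimeGaps, §1 p. 2 (definition of m(ε))] -/
theorem smallGapCount_mono {ε ε' T : ℝ} (h : ε ≤ ε')
    (hfin : {n : ℕ | T ≤ zetaOrdinate n ∧ zetaOrdinate n ≤ 2 * T ∧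
      (zetaOrdinate (n + 1) - zetaOrdinate n) * Real.log T ≤ ε'}.Finite) :
    smallGapCount ε T ≤ smallGapCount ε' T := by
  unfold smallGapCount
  exact Set.ncard_le_ncard (fun n hn => ⟨hn.1, hn.2.1, hn.2.2.trans h⟩) hfin

/-- `DerivLowerBound` is antitone in the constant `c` (for `ε^A ≥ 0`, i.e. `ε > 0`).
[cite: Radziwill2014ZetaPrimeGaps, Main Theorem p. 2] -/
theorem DerivLowerBound.of_le {A c c' ε₀ : ℝ} (hcc : c' ≤ c) (h : DerivLowerBound A c ε₀) :
    DerivLowerBound A c' ε₀ := by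
  intro ε hε hε₀
  obtain ⟨T₀, hT₀⟩ := h ε hε hε₀
  refine ⟨T₀, fun T hT => le_trans ?_ (hT₀ T hT)⟩
  exact mul_le_mul_of_nonneg_right hcc (Real.rpow_nonneg hε.le A)

/-- `DerivLowerBound` is antitone in the range `ε₀`. [cite: Radziwill2014ZetaPrimeGaps, Main Theorem p. 2] -/
theorem DerivLowerBound.of_le_range {A c ε₀ ε₀' : ℝ} (hrange : ε₀' ≤ ε₀)
    (h : DerivLowerBound A c ε₀) : DerivLowerBound A c ε₀' :=
  fun ε hε hε' => h ε hε (hε'.trans hrange)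

end Radziwill2014

/-- **The two parts compose to a self-improvement-free round trip** (PROVED modulo both facts):
under RH, a power-law lower bound `m′(ε) ≫ ε^A` returns, through small gaps of `ζ`, a power-law
lower bound `m′(ε) ≫ ε^{A+2δ}` on `(0,1]` — the printed "log m(ε) ∼ log m′(ε^{1/2})" consistency in
its rendered form. [cite: Radziwill2014ZetaPrimeGaps, Main Theorem and the restatement «log m(ε) ∼ log m′(ε^{1/2})» (p. 2)] -/
theorem radziwill2014_roundTrip (h₁ : radziwill2014_mainTheorem_i)
    (h₂ : radziwill2014_mainTheorem_ii) (hRH : RiemannHypothesis) {A δ : ℝ} (hA : 0 < A)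
    (hδ : 0 < δ) (hyp : ∃ c : ℝ, 0 < c ∧ ∃ ε₀ : ℝ, 0 < ε₀ ∧ DerivLowerBound A c ε₀) :
    ∃ c' : ℝ, 0 < c' ∧ DerivLowerBound (A + δ + δ) c' 1 := by
  obtain ⟨c', hc', hgap⟩ := h₁ hRH A δ hA hδ hyp
  exact h₂ hRH (A + δ) δ (by linarith) hδ ⟨c', hc', 1, one_pos, hgap⟩

/-! ### Ge 2017: one small gap of `ζ` boxes exactly one zero of `ζ′` (Theorems 1–3) -/

namespace Ge2017

/-- **`γ⁺` is the next critical ordinate after `γ`**: "if `ζ(½ + iγ) = 0`, let `γ⁺` denote the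
smallest `t > γ` with `ζ(½ + it) = 0`" — rendered as a predicate on the pair `(γ, γ⁺)`.
[cite: Ge2017ZetaPrimeGaps, §1 p. 1 (definition of γ⁺)] -/
def IsNextCriticalOrdinate (γ γ' : ℝ) : Prop :=
  γ < γ' ∧ riemannZeta (1 / 2 + γ' * Complex.I) = 0 ∧
    ∀ t : ℝ, γ < t → t < γ' → riemannZeta (1 / 2 + t * Complex.I) ≠ 0

/-- The open-in-`σ`, closed-in-`t` box `{σ + it : ½ < σ < ½ + v²/(4 log γ), γ ≤ t ≤ γ⁺}` of
Theorem 2. [cite: Ge2017ZetaPrimeGaps, Theorem 2 (p. 2)] -/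
def box (v γ γ' : ℝ) : Set ℂ :=
  {s : ℂ | 1 / 2 < s.re ∧ s.re < 1 / 2 + v ^ 2 / (4 * Real.log γ) ∧ γ ≤ s.im ∧ s.im ≤ γ'}

end Ge2017

open Ge2017

/-- **Ge 2017, Theorem 1.** "Assume RH. There exists an absolute constant `c > 0`, such that
`m(v/2π) ≤ m′(v²)` for all `v < c`" — in Radziwiłł's normalisation (`Ge`'s `m(v/2π)` counts gaps
with `(γ_{n+1} − γ_n) log T ≤ v`): `liminf_T gapRatio v T ≤ liminf_T derivRatio (v²) T` for
`0 < v < c`. NAMED FACT, not proved here (one direction of the comparison `m′(ε) ≍ m(ε^{1/2})`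
expected by Radziwiłł, here WITHOUT any lower-bound assumption — a theorem of the source).
[cite: Ge2017ZetaPrimeGaps, Theorem 1 (p. 2)] -/
def ge2017_theorem1 : Prop :=
  RiemannHypothesis → ∃ c : ℝ, 0 < c ∧ ∀ v : ℝ, 0 < v → v < c →
    Filter.liminf (fun T : ℝ => gapRatio v T) Filter.atTop ≤
      Filter.liminf (fun T : ℝ => derivRatio (v ^ 2) T) Filter.atTop

/-- **Ge 2017, Theorem 2.** "Assume RH. There exists an absolute constant `c > 0` such that for any
`v < c` the following holds: For all large `γ` with `γ⁺ − γ < v/log γ`, the box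
`{s = σ + it : ½ < σ < ½ + v²/(4 log γ), γ ≤ t ≤ γ⁺}` contains exactly one zero of `ζ′(s)`.
Moreover, the zero is not on the boundary of the box." Rendered: "exactly one" as `∃!` over points
of the box, and the unique zero has `γ < Im ρ′ < γ⁺`. NAMED FACT, not proved here.
[cite: Ge2017ZetaPrimeGaps, Theorem 2 (p. 2)] -/
def ge2017_theorem2 : Prop :=
  RiemannHypothesis → ∃ c : ℝ, 0 < c ∧ ∀ v : ℝ, 0 < v → v < c → ∃ γ₀ : ℝ, ∀ γ γ' : ℝ, γ₀ ≤ γ →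
    riemannZeta (1 / 2 + γ * Complex.I) = 0 → IsNextCriticalOrdinate γ γ' →
      γ' - γ < v / Real.log γ →
        (∃! ρ : ℂ, ρ ∈ box v γ γ' ∧ deriv riemannZeta ρ = 0) ∧
          ∀ ρ : ℂ, ρ ∈ box v γ γ' → deriv riemannZeta ρ = 0 → γ < ρ.im ∧ ρ.im < γ'

/-- **Ge 2017, Theorem 3, displayed consequence (3).** "Assume RH. … In particular, we have
`liminf_{γ′→∞, β′>1/2} (β′ − ½)(log γ′)³ = 0 ⟹ liminf_{γ→∞} (γ⁺ − γ) log γ = 0`." Rendered with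
both `liminf = 0` statements as "for every `η > 0` and every height `Y` there is an instance beyond
`Y` below `η`" (the quantities are `≥ 0`). NAMED FACT, not proved here.
[cite: Ge2017ZetaPrimeGaps, Theorem 3 eq. (3) (p. 3)] -/
def ge2017_theorem3_liminf : Prop :=
  RiemannHypothesis →
    (∀ η : ℝ, 0 < η → ∀ Y : ℝ, ∃ ρ : ℂ, deriv riemannZeta ρ = 0 ∧ 1 / 2 < ρ.re ∧ Y ≤ ρ.im ∧
        (ρ.re - 1 / 2) * Real.log ρ.im ^ (3 : ℕ) < η) →
      ∀ η : ℝ, 0 < η → ∀ Y : ℝ, ∃ γ γ' : ℝ, Y ≤ γ ∧ riemannZeta (1 / 2 + γ * Complex.I) = 0 ∧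
        IsNextCriticalOrdinate γ γ' ∧ (γ' - γ) * Real.log γ < η

/-- A next critical ordinate is a critical zero above `γ`. [cite: Ge2017ZetaPrimeGaps, §1 p. 1 (definition of γ⁺)] -/
theorem Ge2017.IsNextCriticalOrdinate.lt {γ γ' : ℝ} (h : IsNextCriticalOrdinate γ γ') : γ < γ' :=
  h.1

/-- The box shrinks as `v` decreases (for `log γ > 0`). [cite: Ge2017ZetaPrimeGaps, Theorem 2 (p. 2)] -/
theorem Ge2017.box_mono {v v' γ γ' : ℝ} (hv : 0 ≤ v) (hvv : v ≤ v') (hγ : 0 < Real.log γ) :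
    box v γ γ' ⊆ box v' γ γ' := by
  intro s hs
  refine ⟨hs.1, lt_of_lt_of_le hs.2.1 ?_, hs.2.2.1, hs.2.2.2⟩
  have : v ^ 2 ≤ v' ^ 2 := pow_le_pow_left₀ hv hvv 2
  have h4 : 0 < 4 * Real.log γ := by positivity
  simpa using div_le_div_of_nonneg_right this h4.le


end Literature.NumberTheory.LFunctions

end
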